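import Summits.CriticalPhenomena.PercolationContinuityZ3.Theorems.PercNearOneGluingNoHeavyLowerTailCSHUnfold
import Summits.CriticalPhenomena.PercolationContinuityZ3.Theorems.PercNearOneGluingNoHeavyLowerTailMixCSHLevelForms
import HarnessLib

/-!
# `NoHeavyLowerTail` (stmt-CriticalPhenomena-4575) — MIXED conditioned slack hierarchy (hub observer), Lemma U for general `k`:
# TOOLS for the world term of one decoy in the HUB ROW (world hub predicate, alive/dead decoys, Markov merge at `C_Y` with a label-dependent
# test, Markov at `C_d` for a product, the remainder `R'`)

Support file (`--supports stmt-CriticalPhenomena-4575`), prover `prim-hp-7` (gen 33); part (b), tools, of brick B2 (`MixCSHUnfold`) of prim-ineq-gen-7's Lean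
blueprint for THEOREM M1 (memo `prim-ineq-gen-7/PROOF-Q9-MIXED-CSH.md` §3.2–3.3 / §10, write-up `Q9-WRITEUP.md` Lemma 6.3 Steps 2–3).  No named facts,
no sorries.  Sum level (`BHK2006.weight`, `Σ weight = 1`), worlds = delete the pairs meeting `Y ∪ V(C_Y(ω))` (`HullPort.cut Y ω`), in the vocabulary of
prim-hp-8 / prim-ineq-prove-1's pure Lemma U (`CSH.wcovOff`, `CSH.wmeanOff`, `CSH.resid`, `CSH.phiS`, `CSH.decoy_world_term` of `…CSHUnfoldDecoy.lean`)
and of the hub-row level-form algebra `MixCSH.mixChi / mixUnfoldT` (`…MixCSHLevelForms.lean`).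

THE HUB ROW.  Owner `x`, avoided set `Y`, source set `S ∋ x` (owner + earlier decoys), decoy `d ∉ S`, later decoys `L'` (none equal to `d` or to the
hub label `o`), hub set `Σ`; in the world of `ω` (label `ω`, world configuration `β`) the hub predicate is
`Hc^ω_β(u) ⟺ 1{Σ ↮ Y}(ω) ∧ ∃ σ ∈ Σ, u ↔ σ [β]` (`MixCSH.hubPred`; the avoidance factor of the hub test is FROZEN in the world, memo §3.1), and the
`d`-term of the hub-row unfolding (`MixCSH.mixUnfoldT` at `u = o`) is `ε(d)·sl_{L'}[mixChi_{S,d} − c](o)` with the hub entry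
`1{Hc d ∧ ∀ s ∈ S, ¬ Hc s}` (KEY SET IDENTITY).  The companion file `…MixCSHUnfoldDecoy.lean` proves from the tools here (`MixCSH.hub_decoy_world_term`):

  `Σ_ω w(ω) 1{x↮Y}(ω) · Cov_{world(ω)}( g(C_x), ε(d)·sl_{L'}[mixChi_{S,d} − c](o) )`
  `   =  −m₀⁻¹ · sl_{L'}[ w' ↦ m₀·P₁(w') − m₁(w')·P₀ ](o)  +  sl_{L'}[δ_o](o) · R'`,

`E = {d ↮ S ∪ Y}`, `m₀ = μ(E)`, and at a vertex `w'` the pure masses/moments `m₁(w') = μ(E ∩ {d↔w'})`, `P₁(w') = Σ w 1_E 1{d↔w'} Φ(C_d)`, while AT THE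
HUB LABEL `o` they are those of the MIXED decoy test `hubEv Σ d (S ∪ Y) = {Σ ↔ d} ∩ {Σ ↮ S ∪ Y}` (`m₁(o) = μ(E ∩ hubEv)`, `P₁(o) = Σ w 1_{E∩hubEv} Φ(C_d)`),
`P₀ = Σ w 1_E Φ(C_d)`, `c = m₁/m₀` (the mixed decoy constant), and THE REMAINDER

  `R' = Σ_ζ w(ζ) 1_E(ζ) 1{Σ ↔ d}(ζ) · Cov_{off C_d(ζ)}( Θ, 1{Σ ↮ S ∪ Y} )`      (`MixCSH.hubRem`; = `μ(E)·R_j` of the memo),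

`Θ` the telescoping residual `CSH.resid` (the world mean inside it is taken in the FULL graph), the covariance in the fresh configuration off the
pairs meeting `C_d(ζ)` (`CSH.wcovOff w {d}`).  The memo's Lemma R⁻ (brick B3) asserts `R' ≤ 0`; here `R'` is only isolated.
Steps: Markov merge at `C_Y` for a world test depending on the label through `C_Y` (`markov_merge_Y₂`); alive decoy ⇒ the world hub test is the GLOBAL
mixed test `hubEv Σ d (S ∪ Y)` (`world_hub_term_alive`), dead decoy ⇒ the hub entry vanishes (the hub avoids `U_Y ∋ d`) and the term is configuration-free
(`world_hub_term_dead`) and dies against the residual; linearity of `sl_{L'}`; for the vertex entries prim-ineq-prove-1's centred moments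
(`CSH.sum_resid_decoy_moment`), for the hub entry Markov at `C_d` applied to the product `1{Σ↔d}(C_d)·1{Σ↮S∪Y}(off C_d)` (`sum_resid_hub_moment`):
the second factor is NOT a function of `C_d`, whence the covariance remainder `R'`.
[cite: VandenbergHaggstromKahn2005, §2.1 Lemma 2.4 (p. 10); §1 display (10) (pp. 7–8) — corollaries] [cite: KozmaNitzan2024, Question 9 (§5.5 p. 36)]
-/

noncomputable section

namespace Summit.CriticalPhenomena.PercolationContinuityZ3.Theorems

open MeasureTheory Set Literature.Probability.LatticeModels Literature.Probability.Percolation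
open scoped Classical
open BHK2006 DecisionTree HullPort CSH

namespace MixCSH

variable {V : Type*}

/-! ### The world hub predicate and its indicators -/

/-- **The world hub predicate** of the label `ω` read on the world configuration `β`: the hub set `Σ` avoids `Y` in `ω` (the frozen factor of the
hub test) and is joined to `u` in `β`. (transcription of the cell memo prim-ineq-gen-7 PROOF-Q9-MIXED-CSH.md §3.1–3.2, `κ_W(o)` and `J_W(o)`) [folklore] -/
def hubPred (Sig Y : Set V) (ω β : Set (Sym2 V)) (u : V) : Prop :=
  (∀ z ∈ Sig, ∀ y ∈ Y, ¬ (openGraph ω).Reachable y z) ∧ ∃ z ∈ Sig, (openGraph β).Reachable u z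

/-- The world hub predicate is closed under reachability in the world configuration. [folklore] -/
theorem hubPred_closed (Sig Y : Set V) (ω β : Set (Sym2 V)) :
    ∀ a b, hubPred Sig Y ω β a → (openGraph β).Reachable a b → hubPred Sig Y ω β b := by
  rintro a b ⟨hq, z, hz, haz⟩ hab
  exact ⟨hq, z, hz, hab.symm.trans haz⟩

/-- **The global mixed decoy test** `hubEv Σ d A = {Σ ↔ d} ∩ {Σ ↮ A}` as a configuration set (the event `MixCSH.hubEv` of `…MixCSHDefs.lean`,
spelled out so that this file does not depend on the measure-level definitions). [folklore] -/
def hubSet (Sig : Set V) (d : V) (A : Set V) : Set (Set (Sym2 V)) :=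
  {ζ | (∃ z ∈ Sig, (openGraph ζ).Reachable d z) ∧ ∀ z ∈ Sig, ∀ a ∈ A, ¬ (openGraph ζ).Reachable a z}

/-- `1{Σ ↔ d}` as a configuration set. [folklore] -/
def hubTouch (Sig : Set V) (d : V) : Set (Set (Sym2 V)) := {ζ | ∃ z ∈ Sig, (openGraph ζ).Reachable d z}

/-- `1{Σ ↮ A}` as a function of the configuration (the frozen/avoidance factor). [folklore] -/
def hubAvoidInd (Sig A : Set V) (β : Set (Sym2 V)) : ℝ :=
  if (∀ z ∈ Sig, ∀ a ∈ A, ¬ (openGraph β).Reachable a z) then 1 else 0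

/-- `hubSet = hubTouch ∩ {Σ ↮ A}`: `1_{hubSet} = 1_{hubTouch} · hubAvoidInd`. [folklore] -/
theorem ind_hubSet_eq (Sig : Set V) (d : V) (A : Set V) (ζ : Set (Sym2 V)) :
    ind (hubSet Sig d A) ζ = ind (hubTouch Sig d) ζ * hubAvoidInd Sig A ζ := by
  unfold hubAvoidInd
  by_cases h1 : ∃ z ∈ Sig, (openGraph ζ).Reachable d z
  · by_cases h2 : ∀ z ∈ Sig, ∀ a ∈ A, ¬ (openGraph ζ).Reachable a z
    · rw [ind_of_mem (show ζ ∈ hubSet Sig d A from ⟨h1, h2⟩), ind_of_mem (show ζ ∈ hubTouch Sig d from h1), if_pos h2, mul_one]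
    · rw [ind_of_not_mem (show ζ ∉ hubSet Sig d A from fun h => h2 h.2), if_neg h2, mul_zero]
  · rw [ind_of_not_mem (show ζ ∉ hubSet Sig d A from fun h => h1 h.1), ind_of_not_mem (show ζ ∉ hubTouch Sig d from h1), zero_mul]

/-! ### The `d`-term of the hub row read in the world: alive and dead decoys -/

/-- **Alive decoy, hub row**: if `d ↮ Y` in `ζ`, the hub-row world term `ε(d)·sl_{L'}[mixChi_{S,d} − c](o)` in the world `ζ ∖ cut_Y ζ` (label `ζ`)
equals `1{d ↮ S}(ζ) · sl_{L'}[w' ↦ F(w') − c(w')](o)` with the GLOBAL tests `F(w') = 1{d ↔ w'}(ζ)` (`w' ≠ o`) and `F(o) = 1_{hubSet Σ d (S∪Y)}(ζ)`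
(the hub avoids `U_Y(ζ)`, so its world connections are its global ones; memo §3.2 "the GLOBAL form `ω^{(i)}_o = hub(d_i; Y_i)`").
(transcription of the cell memo prim-ineq-gen-7 PROOF-Q9-MIXED-CSH.md §3.2 Step 1) [folklore] -/
theorem world_hub_term_alive {ζ : Set (Sym2 V)} {Y : Set V} {d : V} (h : ζ ∈ avoidEv d Y) (Sig : Set V) (S : Set V) (o : V)
    (L' : List (V × (V → ℝ))) (c : V → ℝ) :
    av (openGraph (ζ \ cut Y ζ)).Reachable S d *
        slForm L' (fun w' => mixChi (openGraph (ζ \ cut Y ζ)).Reachable (hubPred Sig Y ζ (ζ \ cut Y ζ)) o S d w' - c w') o =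
      ind (avoidEv d S) ζ * slForm L' (fun w' =>
        (if w' = o then ind (hubSet Sig d (S ∪ Y)) ζ else ind (openConn d w' : Set (BondConfig V)) ζ) - c w') o := by
  -- the hub entry: world hub test = global mixed test
  have hhub : hubChi (hubPred Sig Y ζ (ζ \ cut Y ζ)) S d = ind (hubSet Sig d (S ∪ Y)) ζ := by
    unfold hubChi
    by_cases hq : ∀ z ∈ Sig, ∀ y ∈ Y, ¬ (openGraph ζ).Reachable y z
    · -- the hub avoids `U_Y(ζ)`: world connections of the hub = global connections
      have hd : ∀ z, (openGraph (ζ \ cut Y ζ)).Reachable d z ↔ (openGraph ζ).Reachable d z :=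
        fun z => reachable_sdiff_cut_iff_of_avoid h z
      have hsv : ∀ s z, z ∈ Sig → ((openGraph (ζ \ cut Y ζ)).Reachable s z ↔ (openGraph ζ).Reachable s z) := by
        intro s z hz
        by_cases hsY : ζ ∈ avoidEv s Y
        · exact reachable_sdiff_cut_iff_of_avoid hsY z
        · -- `s` is joined to `Y`: isolated in the world, and not joined to the hub globally
          constructor
          · intro hr
            have hzs : z = s := eq_of_reachable_sdiff_cut hsY ζ z hr
            subst hzs
            exfalso
            exact hsY fun y hy hzy => hq z hz y hy hzy.symm
          · intro hr
            exfalso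
            have : ∃ y ∈ Y, (openGraph ζ).Reachable s y := by
              by_contra hc; exact hsY fun y hy hsy => hc ⟨y, hy, hsy⟩
            obtain ⟨y, hy, hsy⟩ := this
            exact hq z hz y hy (hsy.symm.trans hr)
      by_cases hE : ζ ∈ hubSet Sig d (S ∪ Y)
      · rw [ind_of_mem hE, if_pos]
        refine ⟨⟨hq, ?_⟩, ?_⟩
        · obtain ⟨z, hz, hdz⟩ := hE.1
          exact ⟨z, hz, (hd z).2 hdz⟩
        · rintro s hs ⟨-, z, hz, hsz⟩
          exact hE.2 z hz s (Or.inl hs) ((hsv s z hz).1 hsz)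
      · rw [ind_of_not_mem hE, if_neg]
        rintro ⟨⟨-, z, hz, hdz⟩, hS⟩
        refine hE ⟨⟨z, hz, (hd z).1 hdz⟩, fun z' hz' a ha har => ?_⟩
        rcases ha with ha | ha
        · exact hS a ha ⟨hq, z', hz', (hsv a z' hz').2 har⟩
        · exact hq z' hz' a ha har
    · have hE : ζ ∉ hubSet Sig d (S ∪ Y) := fun hE => hq fun z hz y hy => hE.2 z hz y (Or.inr hy)
      rw [ind_of_not_mem hE, if_neg (fun h' => hq h'.1.1)]
  have hfun : (fun w' => mixChi (openGraph (ζ \ cut Y ζ)).Reachable (hubPred Sig Y ζ (ζ \ cut Y ζ)) o S d w' - c w') =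
      fun w' => (if w' = o then ind (hubSet Sig d (S ∪ Y)) ζ else ind (openConn d w' : Set (BondConfig V)) ζ) - c w' := by
    funext w'
    by_cases hw' : w' = o
    · subst hw'
      rw [mixChi_hub, hhub, if_pos rfl]
    · rw [mixChi_of_ne _ _ _ _ _ hw', if_neg hw', ← chi_reachable_eq_ind ζ w' d]
      unfold CSH.chi
      rw [show ((openGraph (ζ \ cut Y ζ)).Reachable w' d) = ((openGraph ζ).Reachable w' d) from
        propext (reachable_world_iff_of_alive h w')]
  have hav : av (openGraph (ζ \ cut Y ζ)).Reachable S d = ind (avoidEv d S) ζ := by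
    rw [← av_reachable_eq_ind ζ S d]
    unfold av
    have : (∀ s ∈ S, ¬ (openGraph (ζ \ cut Y ζ)).Reachable d s) ↔ (∀ s ∈ S, ¬ (openGraph ζ).Reachable d s) :=
      forall₂_congr fun s _ => by rw [reachable_sdiff_cut_iff_of_avoid h s]
    rw [show (∀ s ∈ S, ¬ (openGraph (ζ \ cut Y ζ)).Reachable d s) = (∀ s ∈ S, ¬ (openGraph ζ).Reachable d s) from
      propext this]
  rw [hfun, hav]

/-- **Dead decoy, hub row**: if `d ↔ Y` in `ζ`, the hub-row world term is the CONFIGURATION-FREE number `−sl_{L'}[c](o)` (for `d ∉ S`, `d ≠ o`, `d`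
not among the later decoys): `d` is isolated in the world, and the hub — which avoids `U_Y(ζ) ∋ d` whenever its frozen factor is `1` — is not
joined to it. (transcription of the cell memo prim-ineq-gen-7 PROOF-Q9-MIXED-CSH.md §3.2, "worlds with Σ∩W ≠ ∅ have all hub tests 0") [folklore] -/
theorem world_hub_term_dead {ζ : Set (Sym2 V)} {Y : Set V} {d : V} (h : ζ ∉ avoidEv d Y) (Sig : Set V) {S : Set V} (hdS : d ∉ S)
    {o : V} (hod : o ≠ d) (L' : List (V × (V → ℝ))) (hL' : ∀ dc ∈ L', dc.1 ≠ d) (c : V → ℝ) :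
    av (openGraph (ζ \ cut Y ζ)).Reachable S d *
        slForm L' (fun w' => mixChi (openGraph (ζ \ cut Y ζ)).Reachable (hubPred Sig Y ζ (ζ \ cut Y ζ)) o S d w' - c w') o =
      - slForm L' c o := by
  have hav : av (openGraph (ζ \ cut Y ζ)).Reachable S d = 1 := by
    unfold av
    rw [if_pos]
    intro s hs hr
    rw [SimpleGraph.reachable_comm, reachable_world_iff_of_dead h s] at hr
    exact hdS (hr ▸ hs)
  have hchi : ∀ w', w' ≠ d → w' ≠ o →
      mixChi (openGraph (ζ \ cut Y ζ)).Reachable (hubPred Sig Y ζ (ζ \ cut Y ζ)) o S d w' = 0 := by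
    intro w' hw' hw'o
    rw [mixChi_of_ne _ _ _ _ _ hw'o]
    unfold CSH.chi
    rw [if_neg (fun hr => hw' ((reachable_world_iff_of_dead h w').1 hr))]
  have hhub : mixChi (openGraph (ζ \ cut Y ζ)).Reachable (hubPred Sig Y ζ (ζ \ cut Y ζ)) o S d o = 0 := by
    rw [mixChi_hub]
    unfold hubChi
    rw [if_neg]
    rintro ⟨⟨hq, z, hz, hdz⟩, -⟩
    -- `d` is isolated in the world, so `z = d`; but the hub avoids `Y` while `d` is joined to `Y`
    have hzd : z = d := eq_of_reachable_sdiff_cut h ζ z hdz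
    subst hzd
    exact h fun y hy hzy => hq z hz y hy hzy.symm
  have hsl : slForm L' (fun w' => mixChi (openGraph (ζ \ cut Y ζ)).Reachable (hubPred Sig Y ζ (ζ \ cut Y ζ)) o S d w' - c w') o =
      slForm L' (fun w' => (-1 : ℝ) • c w') o := by
    refine slForm_congr L' ?_ fun dc hdc => ?_
    · rw [hhub]; simp
    · by_cases hdco : dc.1 = o
      · rw [hdco, hhub]; simp
      · rw [hchi dc.1 (hL' dc hdc) hdco]; simp
  rw [hav, one_mul, hsl, show (fun w' => (-1 : ℝ) • c w') = (-1 : ℝ) • c from rfl, slForm_smul, Pi.smul_apply,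
    smul_eq_mul]
  ring

/-- `1{Σ ↮ A}` is unchanged by deleting the cut set of a decoy avoiding `A`: a path from `A` to the hub through the cluster of `d` would join
`d` to `A`. [folklore] -/
theorem hubAvoidInd_sdiff_cut_singleton (Sig A : Set V) {d : V} {ζ : Set (Sym2 V)} (h : ζ ∈ avoidEv d A) :
    hubAvoidInd Sig A (ζ \ cut {d} ζ) = hubAvoidInd Sig A ζ := by
  unfold hubAvoidInd
  have : (∀ z ∈ Sig, ∀ a ∈ A, ¬ (openGraph (ζ \ cut {d} ζ)).Reachable a z) ↔
      (∀ z ∈ Sig, ∀ a ∈ A, ¬ (openGraph ζ).Reachable a z) :=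
    forall₂_congr fun z _ => forall₂_congr fun a ha => by rw [reachable_sdiff_cut_singleton_iff (h a ha) z]
  rw [show (∀ z ∈ Sig, ∀ a ∈ A, ¬ (openGraph (ζ \ cut {d} ζ)).Reachable a z) =
      (∀ z ∈ Sig, ∀ a ∈ A, ¬ (openGraph ζ).Reachable a z) from propext this]

variable [Fintype V]

/-! ### Markov merge at `C_Y` for a world test depending on the label through `C_Y` -/

/-- **Markov merge at `C_Y`, label-dependent test.**  For a world test `ψ(C_Y(ω), β)` depending on the label `ω` only through the cluster of `Y`:
`Σ_ω w 1_D(ω) Σ_η w (g(C_x(η')) − ḡ(ω)) ψ(C_Y ω, η')  [η' = η ∖ cut_Y ω]  =  Σ_ζ w 1_D(ζ) (g(C_x ζ) − ḡ(ζ)) ψ(C_Y ζ, ζ ∖ cut_Y ζ)`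
(`HullPort.set_sum_cond_sdiff` read backwards; `CSH.markov_merge_Y` is the label-free case).
[cite: VandenbergHaggstromKahn2005, §2.1 Lemma 2.4 (p. 10) — corollary] -/
theorem markov_merge_Y₂ (w : Sym2 V → ℝ) (hm : ∑ ω, weight w ω = 1) (x : V) (Y : Set V) (g : Set (Sym2 V) → ℝ)
    (ψ : Set (Sym2 V) → Set (Sym2 V) → ℝ) :
    ∑ ω, weight w ω * (ind (avoidEv x Y) ω *
        ∑ η, weight w η * ((g (openEdgeCluster (η \ cut Y ω) x) -
          wmeanOff w Y (fun β => g (openEdgeCluster β x)) ω) * ψ (setCl ω Y) (η \ cut Y ω))) =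
      ∑ ζ, weight w ζ * (ind (avoidEv x Y) ζ *
        ((g (openEdgeCluster ζ x) - wmeanOff w Y (fun β => g (openEdgeCluster β x)) ζ) * ψ (setCl ζ Y) (ζ \ cut Y ζ))) := by
  classical
  set K : Set (Sym2 V) → Set (Sym2 V) → ℝ := fun W β =>
    (if (x ∈ Y ∨ ∃ e ∈ W, x ∈ e) then 0 else 1) *
      ((g (openEdgeCluster β x) - ∑ η', weight w η' * g (openEdgeCluster (η' \ barOf Y W) x)) * ψ W β) with hK
  have hind : ∀ ζ : Set (Sym2 V), ind (avoidEv x Y) ζ = (if (x ∈ Y ∨ ∃ e ∈ setCl ζ Y, x ∈ e) then 0 else 1) := by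
    intro ζ
    by_cases h : (x ∈ Y ∨ ∃ e ∈ setCl ζ Y, x ∈ e)
    · rw [if_pos h, ind_of_not_mem (fun h' => (mem_avoidEv_iff_notMem_span x Y ζ).1 h' h)]
    · rw [if_neg h, ind_of_mem ((mem_avoidEv_iff_notMem_span x Y ζ).2 h)]
  have hmean : ∀ ζ : Set (Sym2 V), wmeanOff w Y (fun β => g (openEdgeCluster β x)) ζ =
      ∑ η', weight w η' * g (openEdgeCluster (η' \ barOf Y (setCl ζ Y)) x) := by
    intro ζ; rw [wmeanOff, cut_eq_barOf]
  have key := set_sum_cond_sdiff w hm Y K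
  have hR : ∀ ω, weight w ω * ∑ η, weight w η * K (setCl ω Y) (η \ barOf Y (setCl ω Y)) =
      weight w ω * (ind (avoidEv x Y) ω * ∑ η, weight w η * ((g (openEdgeCluster (η \ cut Y ω) x) -
        wmeanOff w Y (fun β => g (openEdgeCluster β x)) ω) * ψ (setCl ω Y) (η \ cut Y ω))) := by
    intro ω
    rw [hind, hmean, cut_eq_barOf]
    congr 1
    rw [Finset.mul_sum]
    exact Finset.sum_congr rfl fun η _ => by simp only [hK]; ring
  have hL : ∀ ζ, weight w ζ * K (setCl ζ Y) (ζ \ barOf Y (setCl ζ Y)) =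
      weight w ζ * (ind (avoidEv x Y) ζ * ((g (openEdgeCluster ζ x) -
        wmeanOff w Y (fun β => g (openEdgeCluster β x)) ζ) * ψ (setCl ζ Y) (ζ \ cut Y ζ))) := by
    intro ζ
    simp only [hK]
    rw [hind, hmean, cut_eq_barOf]
    by_cases h : (x ∈ Y ∨ ∃ e ∈ setCl ζ Y, x ∈ e)
    · simp only [if_pos h, zero_mul, mul_zero]
    · have hζ : ζ ∈ avoidEv x Y := (mem_avoidEv_iff_notMem_span x Y ζ).2 h
      have hco := openEdgeCluster_sdiff_cut_of_avoid hζ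
      rw [cut_eq_barOf] at hco
      rw [if_neg h, hco]
  calc _ = ∑ ω, weight w ω * ∑ η, weight w η * K (setCl ω Y) (η \ barOf Y (setCl ω Y)) :=
        Finset.sum_congr rfl fun ω _ => (hR ω).symm
    _ = ∑ ζ, weight w ζ * K (setCl ζ Y) (ζ \ barOf Y (setCl ζ Y)) := key.symm
    _ = _ := Finset.sum_congr rfl fun ζ _ => hL ζ

/-! ### Markov at the cluster of the decoy for a product `f(C_d) · F(off C_d)` -/

/-- **Markov at the cluster of the decoy for a product.**  For a function `f` of the open edge cluster of `d`, an avoided set `A ⊇ {x} ∪ Y`, and a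
configuration function `F` that does not see the pairs meeting `C_d` on `{d ↮ A}`:
`Σ_ζ w 1{d↮A} f(C_d) · Θ(ζ)F(ζ) = Σ_ζ w 1{d↮A} f(C_d) · Σ_η w(η) Θ(η ∖ cut_d ζ) F(η ∖ cut_d ζ)` (world mean off the cluster of `d`).
[cite: VandenbergHaggstromKahn2005, §2.1 Lemma 2.4 (p. 10) — corollary] -/
theorem sum_resid_clusterFn_offFn (w : Sym2 V → ℝ) (hm : ∑ ω, weight w ω = 1) (x : V) (Y : Set V) (g : Set (Sym2 V) → ℝ)
    (d : V) {A : Set V} (hA : insert x Y ⊆ A) (f : Set (Sym2 V) → ℝ) (F : Set (Sym2 V) → ℝ)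
    (hF : ∀ ζ, ζ ∈ avoidEv d A → F (ζ \ cut {d} ζ) = F ζ) :
    ∑ ζ, weight w ζ * (ind (avoidEv d A) ζ * f (openEdgeCluster ζ d) * (resid w x Y g ζ * F ζ)) =
      ∑ ζ, weight w ζ * (ind (avoidEv d A) ζ * f (openEdgeCluster ζ d) *
        wmeanOff w {d} (fun β => resid w x Y g β * F β) ζ) := by
  classical
  set K : Set (Sym2 V) → Set (Sym2 V) → ℝ := fun W β =>
    (if (∀ a ∈ A, ¬ (a ∈ ({d} : Set V) ∨ ∃ e ∈ W, a ∈ e)) then 1 else 0) * f W * (resid w x Y g β * F β) with hK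
  have key := set_sum_cond_sdiff w hm {d} K
  have hL : ∀ ζ, weight w ζ * K (setCl ζ {d}) (ζ \ barOf {d} (setCl ζ {d})) =
      weight w ζ * (ind (avoidEv d A) ζ * f (openEdgeCluster ζ d) * (resid w x Y g ζ * F ζ)) := by
    intro ζ
    simp only [hK]
    rw [← ind_avoidEv_eq_ite_cluster d A ζ, ← cut_eq_barOf, setCl_singleton]
    by_cases h : ζ ∈ avoidEv d A
    · rw [resid_sdiff_cut_singleton w g (fun a ha => h a (hA ha)), hF ζ h]
    · rw [ind_of_not_mem h]; ring
  have hR : ∀ ζ, weight w ζ * ∑ η, weight w η * K (setCl ζ {d}) (η \ barOf {d} (setCl ζ {d})) =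
      weight w ζ * (ind (avoidEv d A) ζ * f (openEdgeCluster ζ d) *
        wmeanOff w {d} (fun β => resid w x Y g β * F β) ζ) := by
    intro ζ
    simp only [hK]
    rw [← ind_avoidEv_eq_ite_cluster d A ζ, ← cut_eq_barOf, setCl_singleton, wmeanOff]
    congr 1
    rw [Finset.mul_sum]
    exact Finset.sum_congr rfl fun η _ => by ring
  calc _ = ∑ ζ, weight w ζ * K (setCl ζ {d}) (ζ \ barOf {d} (setCl ζ {d})) :=
        Finset.sum_congr rfl fun ζ _ => (hL ζ).symm
    _ = ∑ ζ, weight w ζ * ∑ η, weight w η * K (setCl ζ {d}) (η \ barOf {d} (setCl ζ {d})) := key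
    _ = _ := Finset.sum_congr rfl fun ζ _ => hR ζ

/-- **Markov at the cluster of the decoy, plain form** (no residual): for `f` a function of the edge cluster of `d` and `F` blind to the pairs meeting
`C_d` on `{d ↮ A}`, `Σ_ζ w 1{d↮A} f(C_d) F(ζ) = Σ_ζ w 1{d↮A} f(C_d) · (Σ_η w F(η ∖ cut_d ζ))`.
[cite: VandenbergHaggstromKahn2005, §2.1 Lemma 2.4 (p. 10) — corollary] -/
theorem sum_clusterFn_offFn (w : Sym2 V → ℝ) (hm : ∑ ω, weight w ω = 1) (d : V) (A : Set V)
    (f : Set (Sym2 V) → ℝ) (F : Set (Sym2 V) → ℝ) (hF : ∀ ζ, ζ ∈ avoidEv d A → F (ζ \ cut {d} ζ) = F ζ) :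
    ∑ ζ, weight w ζ * (ind (avoidEv d A) ζ * f (openEdgeCluster ζ d) * F ζ) =
      ∑ ζ, weight w ζ * (ind (avoidEv d A) ζ * f (openEdgeCluster ζ d) * wmeanOff w {d} F ζ) := by
  classical
  set K : Set (Sym2 V) → Set (Sym2 V) → ℝ := fun W β =>
    (if (∀ a ∈ A, ¬ (a ∈ ({d} : Set V) ∨ ∃ e ∈ W, a ∈ e)) then 1 else 0) * f W * F β with hK
  have key := set_sum_cond_sdiff w hm {d} K
  have hL : ∀ ζ, weight w ζ * K (setCl ζ {d}) (ζ \ barOf {d} (setCl ζ {d})) =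
      weight w ζ * (ind (avoidEv d A) ζ * f (openEdgeCluster ζ d) * F ζ) := by
    intro ζ
    simp only [hK]
    rw [← ind_avoidEv_eq_ite_cluster d A ζ, ← cut_eq_barOf, setCl_singleton]
    by_cases h : ζ ∈ avoidEv d A
    · rw [hF ζ h]
    · rw [ind_of_not_mem h]; ring
  have hR : ∀ ζ, weight w ζ * ∑ η, weight w η * K (setCl ζ {d}) (η \ barOf {d} (setCl ζ {d})) =
      weight w ζ * (ind (avoidEv d A) ζ * f (openEdgeCluster ζ d) * wmeanOff w {d} F ζ) := by
    intro ζ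
    simp only [hK]
    rw [← ind_avoidEv_eq_ite_cluster d A ζ, ← cut_eq_barOf, setCl_singleton, wmeanOff]
    congr 1
    rw [Finset.mul_sum]
    exact Finset.sum_congr rfl fun η _ => by ring
  calc _ = ∑ ζ, weight w ζ * K (setCl ζ {d}) (ζ \ barOf {d} (setCl ζ {d})) :=
        Finset.sum_congr rfl fun ζ _ => (hL ζ).symm
    _ = ∑ ζ, weight w ζ * ∑ η, weight w η * K (setCl ζ {d}) (η \ barOf {d} (setCl ζ {d})) := key
    _ = _ := Finset.sum_congr rfl fun ζ _ => hR ζ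

/-! ### The remainder `R'` and the centred hub moment -/

/-- **The remainder of the hub row** (the memo's `μ(E_j)·R_j`): `R' = Σ_ζ w(ζ) 1{d ↮ A}(ζ) 1{Σ ↔ d}(ζ) · Cov_{off C_d(ζ)}(Θ, 1{Σ ↮ A})`, the
covariance taken in the fresh configuration off the pairs meeting the cluster of `d` (`CSH.wcovOff w {d}`), `Θ = CSH.resid` (world mean in the FULL
graph).  Lemma R⁻ of the memo (brick B3) asserts `R' ≤ 0`.
(transcription of the cell memo prim-ineq-gen-7 PROOF-Q9-MIXED-CSH.md §3.2 Step 3 / §3.3, `R_j`) [folklore] -/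
def hubRem (w : Sym2 V → ℝ) (x : V) (Y : Set V) (g : Set (Sym2 V) → ℝ) (Sig : Set V) (d : V) (A : Set V) : ℝ :=
  ∑ ζ, weight w ζ * (ind (avoidEv d A) ζ * ind (hubTouch Sig d) ζ *
    wcovOff w {d} (resid w x Y g) (hubAvoidInd Sig A) ζ)

/-- `1{Σ ↔ d}` read off the edge cluster of `d`. [folklore] -/
theorem ind_hubTouch_eq_ite_cluster (Sig : Set V) (d : V) (ζ : Set (Sym2 V)) :
    ind (hubTouch Sig d) ζ = if (∃ z ∈ Sig, z = d ∨ ∃ e ∈ openEdgeCluster ζ d, z ∈ e) then (1 : ℝ) else 0 := by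
  by_cases h : ∃ z ∈ Sig, (openGraph ζ).Reachable d z
  · have h' : ∃ z ∈ Sig, z = d ∨ ∃ e ∈ openEdgeCluster ζ d, z ∈ e := by
      obtain ⟨z, hz, hr⟩ := h
      exact ⟨z, hz, (reachable_iff_exists_mem_openEdgeCluster ζ d z).1 hr⟩
    rw [ind_of_mem (show ζ ∈ hubTouch Sig d from h), if_pos h']
  · have h' : ¬ ∃ z ∈ Sig, z = d ∨ ∃ e ∈ openEdgeCluster ζ d, z ∈ e := by
      rintro ⟨z, hz, hh⟩
      exact h ⟨z, hz, (reachable_iff_exists_mem_openEdgeCluster ζ d z).2 hh⟩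
    rw [ind_of_not_mem (show ζ ∉ hubTouch Sig d from h), if_neg h']

end MixCSH

end Summit.CriticalPhenomena.PercolationContinuityZ3.Theorems

end
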